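import Mathlib
import HarnessLib

/-!
# HodgeLocusCensusQuarticCore — kernel-checked core of the QUARTIC PAIRS record (cell pub-hlocus, LEAD gen 28; THIRTY-NINTH ADDENDUM)
HONEST FRAMING: certified instances and evidence bearing on the general Hodge conjecture; no claim.

Structural helper of the Hodge-locus census; nothing here is used by, or claims anything about, `Summit.HodgeConjecture`.
Record: `data/ivhs/census/og81/QUARTIC-PAIRS-g28.md` (§3c jump-budget lemma, §6b inconsistent-edge lemma and uniform threshold,
§1/§6 the codimension table).  What is kernel-checked here, over an arbitrary field:

* `finrank_ker_add_smul_le` — the JUMP BOUND (the one-value case of the record's jump-budget lemma): for linear maps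
  `A B : V → W` and `μ ≠ 0`, `dim ker (A + μ B) ≤ dim (ker A ∩ ker B) + dim (im A ∩ im B)`.  In the census dictionary
  (`A, B` = multiplication by the two cycle classes on a graded piece of the Jacobian ring) the left side minus
  `dim (ker A ∩ ker B)` is the first-order excess `e(μ)` and `im A ∩ im B = J`; so `e(μ) ≤ dim J` for every `μ ≠ 0`, and in
  particular `J = 0 ⇒ e ≡ 0` with no sampling of `μ` (this sharpens `…ProductCore.ker_add_smul_eq_of_range_inf_eq_bot`).
* `ker_add_smul_eq_inf_of_finrank_eq_zero` — the `J = 0` case as an equality of kernels, derived from the bound-free argument.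
* `edge_minor_ne_zero` — the 2 × 2 minor behind the INCONSISTENT-EDGE LEMMA: for `ε ≠ ε'` nonzero, the coefficient vectors
  `(ε, ε²)` and `(ε', ε'²)` are not proportional (`ε ε'² − ε² ε' ≠ 0`), which is why `J^{(ab)}_s = 0` below the top degree.
* `threshold_iff` — the arithmetic of the UNIFORM THRESHOLD `c′ (d − 2) ≤ d`: it reads `c′ ≤ 3, 2, 1` for `d = 3, 4, ≥ 5`;
  `villaflor_threshold_iff` — Villaflor's standard-pair bound `m < n/2 − d/(d−2)` is the same inequality `d < c′ (d − 2)`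
  for `n = 2k − 2`, `m = k − 1 − c′`.
* `cN_table`, `rankAlpha_table`, `jump_budget_c1` — the printed numbers: the pair-locus codimensions `c_N(k, m)` used in the
  record for `k = 3..7`, `rank α = C(k+3, 4) − k²`, and the identity `C(k,2) − (k−1) = C(k−1,2)` (the `λ = +1` jump of the
  type `[4, 2^{k−2}]` exhausts its budget).
-/

namespace Summit.HodgeConjecture.HodgeConjecture.HodgeLocus.Census.QuarticCore

section Pencil

variable {K : Type*} [Field K] {V W : Type*} [AddCommGroup V] [Module K V] [AddCommGroup W] [Module K W]

/-- JUMP BOUND: `dim ker (A + μ B) ≤ dim (ker A ∩ ker B) + dim (im A ∩ im B)` for `μ ≠ 0`.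
Proof: `g ↦ A g` maps `ker (A + μ B)` into `im A ∩ im B` with kernel inside `ker A ∩ ker B`. -/
theorem finrank_ker_add_smul_le [FiniteDimensional K V] [FiniteDimensional K W] (A B : V →ₗ[K] W) (μ : K) (hμ : μ ≠ 0) :
    Module.finrank K (LinearMap.ker (A + μ • B)) ≤
      Module.finrank K ↥(LinearMap.ker A ⊓ LinearMap.ker B) + Module.finrank K ↥(LinearMap.range A ⊓ LinearMap.range B) := by
  set S := LinearMap.ker (A + μ • B) with hS
  let φ : S →ₗ[K] W := A.comp S.subtype
  have hrn : Module.finrank K (LinearMap.range φ) + Module.finrank K (LinearMap.ker φ) = Module.finrank K S :=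
    LinearMap.finrank_range_add_finrank_ker φ
  -- the range of φ lies in `im A ∩ im B`
  have h1 : LinearMap.range φ ≤ LinearMap.range A ⊓ LinearMap.range B := by
    rintro w ⟨g, rfl⟩
    have hg : A g.1 + μ • B g.1 = 0 := by
      have h := LinearMap.map_coe_ker (A + μ • B) g
      simpa only [LinearMap.add_apply, LinearMap.smul_apply] using h
    refine ⟨LinearMap.mem_range_self A g.1, ?_⟩
    have hAg : A g.1 = B ((-μ) • g.1) := by
      rw [LinearMap.map_smul, neg_smul]; exact eq_neg_of_add_eq_zero_left hg
    show A g.1 ∈ LinearMap.range B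
    rw [hAg]; exact LinearMap.mem_range_self B _
  -- the kernel of φ injects into `ker A ∩ ker B`
  have h2 : Module.finrank K (LinearMap.ker φ) ≤ Module.finrank K ↥(LinearMap.ker A ⊓ LinearMap.ker B) := by
    let ψ : LinearMap.ker φ →ₗ[K] ↥(LinearMap.ker A ⊓ LinearMap.ker B) :=
      { toFun := fun g => ⟨g.1.1, by
          have hφ : A g.1.1 = 0 := by
            have h := LinearMap.map_coe_ker φ g
            simpa only [φ, LinearMap.comp_apply, Submodule.subtype_apply] using h
          have hg : A g.1.1 + μ • B g.1.1 = 0 := by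
            have h := LinearMap.map_coe_ker (A + μ • B) g.1
            simpa only [LinearMap.add_apply, LinearMap.smul_apply] using h
          refine ⟨hφ, ?_⟩
          show B g.1.1 = 0
          rw [hφ, zero_add, smul_eq_zero] at hg
          exact hg.resolve_left hμ⟩
        map_add' := by intro x y; rfl
        map_smul' := by intro c x; rfl }
    have hinj : Function.Injective ψ := by
      intro x y hxy
      have : x.1.1 = y.1.1 := congrArg (fun z => z.1) hxy
      exact Subtype.ext (Subtype.ext this)
    exact LinearMap.finrank_le_finrank_of_injective hinj
  have h3 : Module.finrank K (LinearMap.range φ) ≤ Module.finrank K ↥(LinearMap.range A ⊓ LinearMap.range B) :=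
    Submodule.finrank_mono h1
  omega

/-- The `J = 0` case: if `im A ∩ im B` is zero-dimensional then `ker (A + μ B) = ker A ∩ ker B` for `μ ≠ 0`
(so the first-order excess vanishes at EVERY `μ ≠ 0`). -/
theorem ker_add_smul_eq_inf_of_finrank_eq_zero [FiniteDimensional K W] (A B : V →ₗ[K] W) (μ : K) (hμ : μ ≠ 0)
    (hJ : Module.finrank K ↥(LinearMap.range A ⊓ LinearMap.range B) = 0) :
    LinearMap.ker (A + μ • B) = LinearMap.ker A ⊓ LinearMap.ker B := by
  have hbot : LinearMap.range A ⊓ LinearMap.range B = ⊥ := Submodule.finrank_eq_zero.mp hJ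
  ext x
  simp only [LinearMap.mem_ker, LinearMap.add_apply, LinearMap.smul_apply, Submodule.mem_inf]
  constructor
  · intro hx
    have hA : A x ∈ LinearMap.range A ⊓ LinearMap.range B := by
      refine ⟨LinearMap.mem_range_self A x, ?_⟩
      have : A x = B ((-μ) • x) := by
        rw [LinearMap.map_smul, neg_smul]; exact eq_neg_of_add_eq_zero_left hx
      rw [this]; exact LinearMap.mem_range_self B _
    rw [hbot, Submodule.mem_bot] at hA
    refine ⟨hA, ?_⟩
    rw [hA, zero_add, smul_eq_zero] at hx
    exact hx.resolve_left hμ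
  · rintro ⟨hA, hB⟩
    rw [hA, hB, smul_zero, add_zero]

/-- Consequence used throughout the record: with `J = 0`, `dim ker (A + μ B) = dim (ker A ∩ ker B)` for every `μ ≠ 0`. -/
theorem finrank_ker_add_smul_eq_of_finrank_eq_zero [FiniteDimensional K W] (A B : V →ₗ[K] W) (μ : K) (hμ : μ ≠ 0)
    (hJ : Module.finrank K ↥(LinearMap.range A ⊓ LinearMap.range B) = 0) :
    Module.finrank K (LinearMap.ker (A + μ • B)) = Module.finrank K ↥(LinearMap.ker A ⊓ LinearMap.ker B) := by
  rw [ker_add_smul_eq_inf_of_finrank_eq_zero A B μ hμ hJ]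

end Pencil

section Edge

variable {K : Type*} [Field K]

/-- INCONSISTENT-EDGE minor: for distinct nonzero `ε, ε'` the vectors `(ε, ε²)`, `(ε', ε'²)` are linearly independent. -/
theorem edge_minor_ne_zero {ε ε' : K} (hε : ε ≠ 0) (hε' : ε' ≠ 0) (h : ε ≠ ε') :
    ε * ε' ^ 2 - ε ^ 2 * ε' ≠ 0 := by
  have : ε * ε' ^ 2 - ε ^ 2 * ε' = ε * ε' * (ε' - ε) := by ring
  rw [this]
  exact mul_ne_zero (mul_ne_zero hε hε') (sub_ne_zero.mpr (Ne.symm h))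

/-- The general step: two geometric coefficient vectors `(ε, ε², …)`, `(ε', ε'², …)` with nonzero ratio-bases are proportional
only if `ε = ε'` — proportionality of the first two entries already forces it. -/
theorem eq_of_geometric_proportional {ε ε' t : K} (hε : ε ≠ 0) (hε' : ε' ≠ 0) (h1 : t * ε = ε') (h2 : t * ε ^ 2 = ε' ^ 2) :
    ε = ε' := by
  subst h1
  have ht : t ≠ 0 := fun h => hε' (by rw [h, zero_mul])
  have h3 : t * ε ^ 2 * 1 = t * ε ^ 2 * t := by
    calc t * ε ^ 2 * 1 = (t * ε) ^ 2 := by rw [mul_one, h2]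
      _ = t * ε ^ 2 * t := by ring
  have h4 : (1 : K) = t := mul_left_cancel₀ (mul_ne_zero ht (pow_ne_zero 2 hε)) h3
  rw [← h4, one_mul]

end Edge

section Threshold

/-- UNIFORM THRESHOLD arithmetic: for `d ≥ 3`, `c (d − 2) ≤ d` iff `c ≤ 3` (`d = 3`), `c ≤ 2` (`d = 4`), `c ≤ 1` (`d ≥ 5`). -/
theorem threshold_iff (d c : ℕ) (hd : 3 ≤ d) :
    c * (d - 2) ≤ d ↔ (d = 3 ∧ c ≤ 3) ∨ (d = 4 ∧ c ≤ 2) ∨ (5 ≤ d ∧ c ≤ 1) := by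
  obtain ⟨t, rfl⟩ : ∃ t, d = t + 3 := ⟨d - 3, by omega⟩
  have ht : t + 3 - 2 = t + 1 := by omega
  rw [ht]
  rcases Nat.lt_or_ge t 2 with h | h
  · interval_cases t <;> omega
  · constructor
    · intro hc
      right; right
      refine ⟨by omega, ?_⟩
      rcases Nat.lt_or_ge c 2 with hc1 | hc1
      · omega
      · have : 2 * (t + 1) ≤ c * (t + 1) := Nat.mul_le_mul_right (t + 1) hc1
        omega
    · rintro (⟨h3, _⟩ | ⟨h4, _⟩ | ⟨_, hc⟩)
      · omega
      · omega
      · calc c * (t + 1) ≤ 1 * (t + 1) := Nat.mul_le_mul_right (t + 1) hc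
          _ ≤ t + 3 := by omega

/-- Villaflor's standard-pair threshold `m < n/2 − d/(d−2)` (excess zero) with `n = 2k − 2`, `m = k − 1 − c` is the inequality
`d < c (d − 2)`, i.e. exactly the complement of the uniform threshold `c (d − 2) ≤ d`. -/
theorem villaflor_threshold_iff (d k c : ℕ) (hd : 3 ≤ d) :
    ((k : ℚ) - 1 - c < ((2 * k - 2 : ℚ)) / 2 - d / (d - 2)) ↔ d < c * (d - 2) := by
  have hd2 : (0 : ℚ) < (d : ℚ) - 2 := by
    have : (3 : ℚ) ≤ d := by exact_mod_cast hd
    linarith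
  have e1 : ((2 * k - 2 : ℚ)) / 2 = (k : ℚ) - 1 := by ring
  have e2 : ((d : ℚ) < c * ((d : ℚ) - 2)) ↔ d < c * (d - 2) := by
    rw [show ((d : ℚ) - 2) = ((d - 2 : ℕ) : ℚ) by push_cast [Nat.cast_sub (show 2 ≤ d by omega)]; ring]
    norm_cast
  rw [e1, ← e2, ← div_lt_iff₀ hd2]
  constructor <;> intro h <;> linarith

end Threshold

section Tables

/-- The pair-locus codimension `c_N(k, m) = 2 C(k+3,4) − C(m+4,4) − [(m+1)(2k−m−1) + 2k(k−1−m)]` at the values used in the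
record (d = 4): (k; m) = (3; 1, 0), (4; 2, 1, 0), (5; 3, 2), (6; 4, 3), (7; 5, 4) give 11, 12, 32, 37, 38, 71, 84, 135, 161, 232, 277. -/
theorem cN_table :
    2 * Nat.choose 6 4 - Nat.choose 5 4 - (2 * 4 + 6 * 1) = 11 ∧ 2 * Nat.choose 6 4 - Nat.choose 4 4 - (1 * 5 + 6 * 2) = 12 ∧
    2 * Nat.choose 7 4 - Nat.choose 6 4 - (3 * 5 + 8 * 1) = 32 ∧ 2 * Nat.choose 7 4 - Nat.choose 5 4 - (2 * 6 + 8 * 2) = 37 ∧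
    2 * Nat.choose 7 4 - Nat.choose 4 4 - (1 * 7 + 8 * 3) = 38 ∧
    2 * Nat.choose 8 4 - Nat.choose 7 4 - (4 * 6 + 10 * 1) = 71 ∧ 2 * Nat.choose 8 4 - Nat.choose 6 4 - (3 * 7 + 10 * 2) = 84 ∧
    2 * Nat.choose 9 4 - Nat.choose 8 4 - (5 * 7 + 12 * 1) = 135 ∧ 2 * Nat.choose 9 4 - Nat.choose 7 4 - (4 * 8 + 12 * 2) = 161 ∧
    2 * Nat.choose 10 4 - Nat.choose 9 4 - (6 * 8 + 14 * 1) = 232 ∧ 2 * Nat.choose 10 4 - Nat.choose 8 4 - (5 * 9 + 14 * 2) = 277 := by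
  decide

/-- `rank α = C(k+3, 4) − k²` (codimension of `NL(P)` for a `(k−1)`-plane in a quartic `(2k−2)`-fold at the Fermat point) for k = 3..7:
6, 19, 45, 90, 161 (the values printed by both engines). -/
theorem rankAlpha_table :
    Nat.choose 6 4 - 3 ^ 2 = 6 ∧ Nat.choose 7 4 - 4 ^ 2 = 19 ∧ Nat.choose 8 4 - 5 ^ 2 = 45 ∧ Nat.choose 9 4 - 6 ^ 2 = 90 ∧
    Nat.choose 10 4 - 7 ^ 2 = 161 := by
  decide

/-- Budget exhaustion for the type `[4, 2^{k−2}]`: `dim J − e_gen = C(k,2) − (k−1) = C(k−1,2)` = the jump at `λ = +1`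
(`e(1) = C(k,2)`), for every `k ≥ 1` (stated with `k = j + 1`). -/
theorem jump_budget_c1 (j : ℕ) : Nat.choose (j + 1) 2 - j = Nat.choose j 2 := by
  have h : Nat.choose (j + 1) 2 = j + Nat.choose j 2 := by simpa using Nat.choose_succ_succ' j 1
  omega

end Tables

end Summit.HodgeConjecture.HodgeConjecture.HodgeLocus.Census.QuarticCore
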